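import Summits.SmoothPoincare4.SmoothPoincare4.Theorems.RootDecompAEDoublesShadowLEOnePeelCombine

/-!
# Peeling theorem for KMN encoding graphs, part 7/8: the peeling recursion; the unimodular start

§7 (last part) `peel_rec`: every peeling state `(R, L)` whose block `rows(R, L) × cols(R)` of the exponent table
is unimodular has a certificate — peel a leaf `u` of `R`; the rank bounds leave two cases, BOTTOM (`u` joins `L`,
its letters ranked lowest) and TOP (`u` also owns the tree edge towards `R`, its letters ranked highest); the
determinant factors through the block-triangular shape, (★) certifies the block at `u`, induction the rest.
§8 (first part) The unimodular start `um_top`: if `P(G)` presents the trivial group and all gluings are tree edges,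
the block `gluing rows × used letters` is unimodular (the full exponent table is, and the one-letter killing
relators form a permutation block on the other letters).

THE FAMILY (eight modules `Theorems/RootDecompAEDoublesShadowLEOnePeel*.lean` + the closing module
`Theorems/RootDecompAEDoublesShadowLEOneStubPeelCertificates.lean`, one namespace
`Summit.SmoothPoincare4.SmoothPoincare4.Theorems.RootDecompAEDoublesShadowLEOneStubPeelCertificates`, split by topic to respect the
400-line bound on proof files): `…PeelDefs` (verbatim twins of the skeleton's `Piece`, `ShadowGraph`,
`PeelCertificates`; free-group exponent sums; `H₁ = 0 ⟹` unimodular exponent matrix) · `…PeelBlocks` (unimodular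
finset-indexed blocks of an integer table: splitting and rank bounds; the tree of pieces and its leaves) ·
`…PeelLocalTable` (the local table (★) of the twelve pieces) · `…PeelTable` (exponent sums of the relators of `P(G)`;
rows and used letters of a peeling state) · `…PeelLocalStep` (the geometry of a gluing at a piece; local certificate
data from local unimodularity) · `…PeelCombine` (certificates of peeling states; the combination step; the set
algebra of one peeling step) · `…PeelRecursion` (the peeling recursion; the unimodular start) ·
`…StubPeelCertificates` (step L0 and the extraction: `theorem stub_peelCertificates : PeelCertificates`).
-/

open Function
open Literature.Topology.FourManifolds

set_option linter.dupNamespace false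

noncomputable section

namespace Summit.SmoothPoincare4.SmoothPoincare4.Theorems.RootDecompAEDoublesShadowLEOneStubPeelCertificates

namespace ShadowGraph

variable {G : ShadowGraph}

/-! ### The peeling recursion -/

/-- **PEELING.**  Every peeling state `(R, L)` (`R` a sub-tree of pieces still to peel, `L` the pieces already
peeled to the bottom, `R ∩ L = ∅`) whose block `rows(R, L) × cols(R)` of the exponent table is unimodular admits a
certificate with all ranks `≥ lo`.  Induction on `#R`: peel a leaf `u` of `R`; the rank bounds force the number of
cap rows at `u` to be `rank(u)` (BOTTOM: `u` joins `L`, its letters are ranked lowest) or `rank(u) − 1` (TOP: `u`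
also owns the edge towards `R`, its letters are ranked highest); the determinant factors through the corresponding
block-triangular shape, the local table (★) certifies the block at `u`, and the induction hypothesis the rest. -/
theorem peel_rec (hV : G.PortsValid) (hI : G.PortsInjective) (hT : G.IsSpanningTree) (hall : ∀ e, G.tree e = true) :
    ∀ (n : ℕ) (R L : Finset (Fin G.k)), R.card = n + 1 → Disjoint R L →
      (G.treeAdj.induce (R : Set (Fin G.k))).Connected → UM G.tab (G.rows R L) (G.cols R) →
        ∀ lo : ℕ, G.Cert (G.rows R L) (G.cols R) lo := by
  classical
  have hself : ∀ e, (G.src e).1 ≠ (G.tgt e).1 := fun e => hT.1 e (hall e)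
  obtain ⟨-, hinjE, -⟩ := G.tree_facts hT hall
  intro n
  induction n with
  | zero =>
    intro R L hcard hRL _ hU lo
    obtain ⟨u, rfl⟩ := Finset.card_eq_one.mp hcard
    have huL : u ∉ L := fun h => Finset.disjoint_left.mp hRL (Finset.mem_singleton_self u) h
    -- every row touches `u`, and its far end lies in `L`
    have hru : ∀ e ∈ G.rows {u} L, (G.src e).1 = u ∨ (G.tgt e).1 = u := by
      intro e he
      rw [mem_rows] at he
      simp only [Finset.mem_singleton] at he
      tauto
    have hrows : G.rows {u} L = G.rows {u} L ∪ G.rows (({u} : Finset (Fin G.k)).erase u) L := by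
      rw [Finset.erase_singleton, rows_empty, Finset.union_empty]
    have hdisj : Disjoint (G.rows {u} L) (G.rows (({u} : Finset (Fin G.k)).erase u) L) := by
      rw [Finset.erase_singleton, rows_empty]; exact Finset.disjoint_empty_right _
    have hcardru : (G.rows {u} L).card = (G.piece u).rank := by rw [hU.card_eq, cols_singleton_card]
    obtain ⟨lamU, tU, lr, hloc⟩ := local_step hV hI hself u (G.rows {u} L) hru hcardru hU
    refine combine hself {u} L L u (Finset.mem_singleton_self u) (G.rows {u} L) hru hrows hdisj lo (lo + 2) lo
      le_rfl (by omega) (Or.inr le_rfl) (fun e => Sum.inr e) (fun _ => 0) (fun _ => false) ?_ ?_ ?_ ?_ ?_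
      lamU tU lr hloc
    · simp [Finset.erase_singleton, rows_empty]
    · simp [Finset.erase_singleton, rows_empty]
    · simp [Finset.erase_singleton, cols_empty]
    · simp [Finset.erase_singleton, rows_empty]
    · intro e he i hmem
      have hoL : G.other e u ∈ L := by
        rcases other_mem he (hru e he) with h | h
        · rw [Finset.mem_singleton] at h; exact absurd h (other_ne (hself e))
        · exact h
      simp [Finset.erase_singleton, cols_empty] at hmem
  | succ n ih =>
    intro R L hcard hRL hconn hU lo
    obtain ⟨u, hu, z, hz, huz, hadj, huniq, hconn'⟩ := G.exists_leaf hT hall R hconn (by omega)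
    have huL : u ∉ L := fun h => Finset.disjoint_left.mp hRL hu h
    obtain ⟨-, δ, -, hδ⟩ := (G.treeAdj_iff u z).mp hadj
    have hδt := (touches_of_epair hδ).1
    have hδo : G.other δ u = z := other_eq_of_epair (hself δ) hδ
    have hδrows : δ ∈ G.rows R L := by
      rw [mem_rows]
      rcases ends_eq hδt with ⟨h1, h2⟩ | ⟨h1, h2⟩
      · exact Or.inl ⟨h1 ▸ hu, Or.inl (by rw [h2, hδo]; exact hz)⟩
      · exact Or.inr ⟨h1 ▸ hu, Or.inl (by rw [h2, hδo]; exact hz)⟩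
    have hδu : δ ∈ G.urows R L u := mem_urows.mpr ⟨hδrows, hδt⟩
    -- cap rows: every other row at `u` ends in `L`
    have hS : ∀ e ∈ G.urows R L u, e ≠ δ → G.other e u ∈ L := by
      intro e he hne
      obtain ⟨heR, ht⟩ := mem_urows.mp he
      rcases other_mem heR ht with h | h
      · exfalso
        have hw : G.other e u = z := huniq _ h (adj_other hall (hself e) ht)
        have : G.epair e = G.epair δ := by rw [epair_eq ht, hw, hδ]
        exact hne (hinjE this)
      · exact h
    set S := (G.urows R L u).erase δ with hSdef
    have hSsub : S ⊆ G.rows R L := fun e he =>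
      (mem_urows.mp (Finset.mem_of_mem_erase he)).1
    have hurows_card : (G.urows R L u).card = S.card + 1 := by
      rw [hSdef, Finset.card_erase_of_mem hδu]
      have := Finset.card_pos.mpr ⟨δ, hδu⟩
      omega
    have hR'card : (R.erase u).card = n + 1 := by rw [Finset.card_erase_of_mem hu]; omega
    have hR'L : Disjoint (R.erase u) L :=
      Finset.disjoint_of_subset_left (Finset.erase_subset u R) hRL
    -- the used letters of `u`
    have hcu_card : (G.cols {u}).card = (G.piece u).rank := G.cols_singleton_card u
    have hcols := G.cols_eq_union R u hu
    have hcdisj := G.cols_disjoint R u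
    -- rank bounds: `#S ≤ rank u ≤ #S + 1`
    have hle1 : S.card ≤ (G.cols {u}).card := by
      refine hU.card_le_of_rows_supported hSsub fun e he g hg hgu => ?_
      obtain ⟨v, i, rfl, hv, hi⟩ := (G.mem_cols_iff _ _).mp hg
      have hvu : v ≠ u := fun h => hgu (by rw [inl_mem_cols]; exact ⟨by simp [h], h ▸ hi⟩)
      obtain ⟨hed, heu⟩ := Finset.mem_erase.mp he
      obtain ⟨heR, ht⟩ := mem_urows.mp heu
      have hoL := hS e heu hed
      have hvo : v ≠ G.other e u := fun h => Finset.disjoint_left.mp hRL hv (h ▸ hoL)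
      obtain ⟨h1, h2⟩ := ne_ends_of_ne ht hvu hvo
      exact tab_far h1 h2 i
    have hle2 : (G.cols {u}).card ≤ (G.urows R L u).card := by
      refine hU.card_le_of_cols_supported (G.cols_mono (Finset.singleton_subset_iff.mpr hu)) fun g hg e he heu => ?_
      obtain ⟨v, i, rfl, hv, -⟩ := (G.mem_cols_iff _ _).mp hg
      rw [Finset.mem_singleton] at hv
      subst hv
      have ht : ¬((G.src e).1 = v ∨ (G.tgt e).1 = v) := fun h => heu (mem_urows.mpr ⟨he, h⟩)
      push Not at ht
      exact tab_far ht.1 ht.2 i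
    rw [hcu_card] at hle1 hle2
    rw [hurows_card] at hle2
    rcases Nat.eq_or_lt_of_le hle1 with hbot | htop
    · -- BOTTOM: `u` has `rank u` cap rows; it joins `L`, its letters are ranked lowest
      obtain ⟨hrows, hdisj⟩ := rows_split_bot hself hRL hu δ hδu (hδo ▸ hz) hS
      have hU' := hU
      rw [hrows, hcols] at hU'
      have hzero : ∀ i ∈ S, ∀ j ∈ G.cols (R.erase u), G.tab i j = 0 := by
        intro e he g hg
        obtain ⟨v, i, rfl, hv, -⟩ := (G.mem_cols_iff _ _).mp hg
        obtain ⟨hvu, hvR⟩ := Finset.mem_erase.mp hv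
        obtain ⟨hed, heu⟩ := Finset.mem_erase.mp he
        obtain ⟨heR, ht⟩ := mem_urows.mp heu
        have hoL := hS e heu hed
        have hvo : v ≠ G.other e u := fun h => Finset.disjoint_left.mp hRL hvR (h ▸ hoL)
        obtain ⟨h1, h2⟩ := ne_ends_of_ne ht hvu hvo
        exact tab_far h1 h2 i
      obtain ⟨hUu, hUr⟩ := hU'.split_bot hdisj hcdisj (by rw [hcu_card]; exact hbot) hzero
      have hR'L' : Disjoint (R.erase u) (insert u L) := by
        rw [Finset.disjoint_insert_right]
        exact ⟨by simp, hR'L⟩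
      obtain ⟨lam', rk', sg', hinj', hmem', hlo'', hval'⟩ :=
        ih (R.erase u) (insert u L) hR'card hR'L' hconn' hUr (lo + 2)
      have hruS : ∀ e ∈ S, (G.src e).1 = u ∨ (G.tgt e).1 = u := fun e he =>
        (mem_urows.mp (Finset.mem_of_mem_erase he)).2
      obtain ⟨lamU, tU, lr, hloc⟩ := local_step hV hI hself u S hruS (by rw [hbot]) hUu
      refine combine hself R L (insert u L) u hu S hruS hrows hdisj lo (lo + 2) lo le_rfl (by omega)
        (Or.inr le_rfl) lam' rk' sg' hinj' hmem' hlo'' hval' ?_ lamU tU lr hloc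
      intro e he i hmem
      exfalso
      obtain ⟨hed, heu⟩ := Finset.mem_erase.mp he
      have hoL := hS e heu hed
      rw [inl_mem_cols] at hmem
      exact Finset.disjoint_left.mp hRL (Finset.mem_of_mem_erase hmem.1) hoL
    · -- TOP: `u` has `rank u − 1` cap rows and owns the edge towards `R`; its letters are ranked highest
      have htop' : (G.urows R L u).card = (G.piece u).rank := by omega
      obtain ⟨hrows, hdisj, havoid⟩ := rows_split_top (G := G) (R := R) (L := L) huL
      have hU' := hU
      rw [hrows, hcols] at hU'
      have hzero : ∀ i ∈ G.rows (R.erase u) L, ∀ j ∈ G.cols {u}, G.tab i j = 0 := by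
        intro e he g hg
        obtain ⟨v, i, rfl, hv, -⟩ := (G.mem_cols_iff _ _).mp hg
        rw [Finset.mem_singleton] at hv
        subst hv
        obtain ⟨h1, h2⟩ := havoid e he
        exact tab_far h1 h2 i
      obtain ⟨hUu, hUr⟩ := hU'.split_top hdisj hcdisj (by rw [hcu_card]; exact htop') hzero
      obtain ⟨lam', rk', sg', hinj', hmem', hlo'', hval'⟩ := ih (R.erase u) L hR'card hR'L hconn' hUr lo
      have hruU : ∀ e ∈ G.urows R L u, (G.src e).1 = u ∨ (G.tgt e).1 = u := fun e he => (mem_urows.mp he).2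
      obtain ⟨lamU, tU, lr, hloc⟩ := local_step hV hI hself u (G.urows R L u) hruU htop' hUu
      refine combine hself R L L u hu (G.urows R L u) hruU hrows hdisj lo lo
        (lo + (G.cols (R.erase u)).sup rk' + 1) (by omega) le_rfl (Or.inl havoid) lam' rk' sg' hinj' hmem' hlo''
        hval' ?_ lamU tU lr hloc
      intro e _ i hmem
      have := Finset.le_sup (f := rk') hmem
      omega

end ShadowGraph

namespace ShadowGraph

variable (G : ShadowGraph)

/-! ### The unimodular start: `H₁ = 0` makes the gluing block of the exponent table unimodular -/

/-- The FULL exponent table of `P(G)`: exponent sum of the letter `g` in the relator `r`. -/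
def Tab (r : G.Rel) (g : G.Gen) : ℤ := expo g (G.relator r)

/-- The full exponent table is unimodular when `P(G)` presents the trivial group (`H₁ = 0`). -/
theorem um_full {n : ℕ} (eg : G.Gen ≃ Fin n) (er : G.Rel ≃ Fin n)
    (h : (G.presentation eg er).PresentsTrivialGroup) :
    UM G.Tab (Finset.univ : Finset G.Rel) (Finset.univ : Finset G.Gen) := by
  classical
  have hdet := isUnit_det_expoMat (G.presentation eg er)
    ((BalancedPresentation.presentsTrivialGroup_iff_normalClosure_eq_top _).mp h)
  let eR : ((Finset.univ : Finset G.Rel) : Type) ≃ G.Rel := Equiv.subtypeUnivEquiv (fun x => Finset.mem_univ x)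
  let eC : ((Finset.univ : Finset G.Gen) : Type) ≃ G.Gen := Equiv.subtypeUnivEquiv (fun x => Finset.mem_univ x)
  let β : ((Finset.univ : Finset G.Rel) : Type) ≃ ((Finset.univ : Finset G.Gen) : Type) :=
    eR.trans (er.trans (eg.symm.trans eC.symm))
  refine ⟨β, ?_⟩
  have e : blk G.Tab Finset.univ Finset.univ β = (expoMat (G.presentation eg er)).submatrix ⇑(eR.trans er) ⇑(eR.trans er) := by
    ext x y
    simp only [blk, expoMat, Tab, presentation, Matrix.submatrix_apply, Matrix.of_apply, Equiv.trans_apply,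
      expo_map_equiv, Equiv.symm_apply_apply]
    rfl
  rw [e, Matrix.det_submatrix_equiv_self]
  exact hdet

/-- The owner letter of a ONE-LETTER relator (killing relators of stable letters and of unused spine letters),
and a dummy value on gluing relators. -/
def ownLetter : G.Rel → G.Gen
  | Sum.inl e => Sum.inr e
  | Sum.inr (Sum.inl e) => Sum.inr e.1
  | Sum.inr (Sum.inr p) => Sum.inl p.1

/-- At the start of the peeling every gluing is a row. -/
theorem rows_univ : G.rows Finset.univ ∅ = Finset.univ := by
  ext e; simp [mem_rows]

/-- THE UNIMODULAR START.  If `P(G)` presents the trivial group and all gluings are tree edges, the block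
`(gluing rows) × (used letters)` of the exponent table is unimodular: the full table is (`H₁ = 0`), and the
one-letter relators form a permutation block on the complementary letters. -/
theorem um_top (hall : ∀ e, G.tree e = true) {n : ℕ} (eg : G.Gen ≃ Fin n) (er : G.Rel ≃ Fin n)
    (h : (G.presentation eg er).PresentsTrivialGroup) :
    UM G.tab (G.rows Finset.univ ∅) (G.cols Finset.univ) := by
  classical
  have hfull := G.um_full eg er h
  -- split the relator indices into one-letter relators `ru` and gluing relators `r'`
  set ru : Finset G.Rel := Finset.univ.map ⟨Sum.inr, Sum.inr_injective⟩ with hru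
  set r' : Finset G.Rel := Finset.univ.map ⟨Sum.inl, Sum.inl_injective⟩ with hr'
  set cu : Finset G.Gen := Finset.univ.filter fun g => g ∉ G.cols Finset.univ with hcu
  have hrows : (Finset.univ : Finset G.Rel) = ru ∪ r' := by
    ext r
    simp only [Finset.mem_univ, Finset.mem_union, true_iff]
    rcases r with e | x
    · exact Or.inr (by simp [hr'])
    · exact Or.inl (by simp [hru])
  have hcolsU : (Finset.univ : Finset G.Gen) = cu ∪ G.cols Finset.univ := by
    ext g
    simp only [Finset.mem_univ, Finset.mem_union, hcu, Finset.mem_filter, true_and, true_iff]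
    tauto
  have hdr : Disjoint ru r' := by
    rw [Finset.disjoint_left]
    intro r h1 h2
    simp only [hru, hr', Finset.mem_map, Finset.mem_univ, Function.Embedding.coeFn_mk, true_and] at h1 h2
    obtain ⟨x, rfl⟩ := h1
    obtain ⟨e, he⟩ := h2
    cases he
  have hdc : Disjoint cu (G.cols Finset.univ) := by
    rw [Finset.disjoint_left]
    intro g h1 h2
    simp only [hcu, Finset.mem_filter] at h1
    exact h1.2 h2
  -- the one-letter relators are in bijection with the complementary letters
  have hcu_eq : cu = ru.image G.ownLetter := by
    ext g
    simp only [hcu, hru, Finset.mem_filter, Finset.mem_univ, true_and, Finset.mem_image, Finset.mem_map,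
      Function.Embedding.coeFn_mk]
    constructor
    · intro hg
      rcases g with ⟨v, i⟩ | e
      · have hi : (G.piece v).rank ≤ (i : ℕ) := by
          rw [inl_mem_cols] at hg; push Not at hg; exact hg (Finset.mem_univ v)
        exact ⟨Sum.inr (Sum.inr ⟨(v, i), hi⟩), by simp, rfl⟩
      · exact ⟨Sum.inr (Sum.inl ⟨e, hall e⟩), by simp, rfl⟩
    · rintro ⟨r, ⟨x, rfl⟩, rfl⟩
      rcases x with ⟨e, he⟩ | ⟨p, hp⟩
      · exact G.inr_not_mem_cols _ _
      · simp only [ownLetter]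
        rw [show p = (p.1, p.2) from rfl, inl_mem_cols]
        push Not
        intro _
        exact hp
  have hinjOn : Set.InjOn G.ownLetter ru := by
    intro r₁ h₁ r₂ h₂ heq
    simp only [hru, Finset.coe_map, Function.Embedding.coeFn_mk, Set.mem_image, Finset.coe_univ, Set.mem_univ,
      true_and] at h₁ h₂
    obtain ⟨x₁, rfl⟩ := h₁
    obtain ⟨x₂, rfl⟩ := h₂
    rcases x₁ with ⟨e₁, he₁⟩ | ⟨p₁, hp₁⟩ <;> rcases x₂ with ⟨e₂, he₂⟩ | ⟨p₂, hp₂⟩ <;>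
      simp only [ownLetter, Sum.inr.injEq, Sum.inl.injEq, reduceCtorEq] at heq ⊢
    · subst heq; rfl
    · subst heq; rfl
  have hcard : ru.card = cu.card := by
    rw [hcu_eq, Finset.card_image_of_injOn hinjOn]
  have hz : ∀ i ∈ ru, ∀ j ∈ G.cols Finset.univ, G.Tab i j = 0 := by
    intro r hr g hg
    simp only [hru, Finset.mem_map, Finset.mem_univ, Function.Embedding.coeFn_mk, true_and] at hr
    obtain ⟨x, rfl⟩ := hr
    obtain ⟨v, i, rfl, -, hi⟩ := (G.mem_cols_iff _ _).mp hg
    rcases x with ⟨e, he⟩ | ⟨p, hp⟩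
    · simp [Tab, relator, stable]
    · simp only [Tab, relator, expo_of]
      rw [if_neg]
      rintro h
      simp only [Sum.inl.injEq] at h
      rw [h] at hp
      exact absurd hi (not_lt.mpr hp)
  rw [hrows, hcolsU] at hfull
  obtain ⟨-, hU⟩ := hfull.split_bot hdr hdc hcard hz
  -- transport the gluing rows to `Fin m`
  let f : ((G.rows Finset.univ ∅ : Finset (Fin G.m)) : Type) ≃ (r' : Type) :=
    { toFun := fun x => ⟨Sum.inl x.1, by simp [hr']⟩
      invFun := fun y => ⟨Sum.elim id (fun _ => (⟨0, by
          obtain ⟨y, hy⟩ := y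
          simp only [hr', Finset.mem_map, Finset.mem_univ, Function.Embedding.coeFn_mk, true_and] at hy
          obtain ⟨e, -⟩ := hy
          exact Fin.pos e⟩ : Fin G.m)) y.1, by rw [rows_univ]; exact Finset.mem_univ _⟩
      left_inv := fun x => by simp
      right_inv := fun y => by
        obtain ⟨y, hy⟩ := y
        simp only [hr', Finset.mem_map, Finset.mem_univ, Function.Embedding.coeFn_mk, true_and] at hy
        obtain ⟨e, rfl⟩ := hy
        rfl }
  exact UM.of_rowEquiv f (fun x g => by simp [f, tab, Tab, relator]) hU

end ShadowGraph

end Summit.SmoothPoincare4.SmoothPoincare4.Theorems.RootDecompAEDoublesShadowLEOneStubPeelCertificates
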